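import Summits.MatrixMultiplication.MatrixMultiplication.Theorems.FarEdgeDescentSpectralHorn
import Summits.MatrixMultiplication.MatrixMultiplication.Statement
import HarnessLib

/-!
# Route `FarEdgeDescent` — Kernel XXI-C «the node over every field; the top-depth floor»

decomp-mm ROOT cell (D-0178), lens 2 «structural dichotomy: special vs generic», gen 45; third part of the
Theses-free spectral-shadow kernel (`FarEdgeDescentSpectralShadow`, `FarEdgeDescentSpectralHorn`).  Imports
those Theorems modules and `Literature` only; the route's item texts appear INLINE over an arbitrary field
`K` (`FS_K`: `∃ k ≥ 2, ω_K(1,k,1) = k+1`; `ALC_K`: `∀ m > 1, e_K(m)² ≤ e_K(1)·e_K(2m−1)`,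
`e_K(x) = ω_K(1,x,1) − (x+1)`).

§A THE NODE OF RECORD HOLDS OVER EVERY FIELD (the Theses-free, field-uniform home of the shared chord /
   halving / node lemmas of `FarEdgeDescentChord`, which are stated over `ℂ` against the route decls —
   critic g44 lint-debt ask): the chord bound `e(m) ≤ (e(1)+e(2m−1))/2` (convexity, every field), the
   halving step `ALC_K ∧ e(2k−1) = 0 ⟹ e(k) = 0` (real `k > 1`), and
   **`ω_K = 2 ⟺ FS_K ∧ ALC_K`** (`omega_eq_two_iff_node`): the cut `S ⟸ special ∧ generic` decides the
   exponent over EVERY field, with the same two leaves (`matrixMultiplication_iff_node` is the `ℂ` summit,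
   `matrixMultiplicationAllFields_iff_node` the all-fields summit, through the same cut); and the special leaf in
   shadow language with a REAL slope: `FS_K ⟺ ∃ M, ∀φ, d_φ ≤ M·(1−θ₂)` (`finiteSaturationShape_iff_slopeBounded`).
§B THE TOP-DEPTH FLOOR (the generic crux read on the top fibre of the spectrum).  For a TOP universal
   spectral point `φ` (`θ₁+θ₂+θ₃ = ω_K`) with depth `ε = 1 − θ₂` and `τ = ω_K − 2`: unconditionally
   `e(x) ≥ τ − (x−1)ε` (`excess_ge_top_line`); under `ALC_K` and `ω_K > 2`, one doubling gives
   `e(2m−1) ≥ (τ − (m−1)ε)²/τ` (`excess_double_ge_sq`, a quantitative form of top isolation), and `j`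
   doublings give the FLOOR `e(x) ≥ τ·(1 − (x−1)ε/(2^j τ))^{2^j}` for every `j` with `(x−1)ε ≤ 2^j τ`
   (`excess_ge_floor`); letting `j → ∞`, `e(x) ≥ τ·exp(−(x−1)ε/τ)` (`excess_ge_exp_floor`): in the generic world with the crux the
   excess decays no faster than exponentially, at a rate set by the depth of ANY optimal spectral
   certificate of the square (the every-field, top-fibre form of the lineage's `ExpFloor`/`TameProfile`
   floors, which are parametrised by `e(2)/e(1)` instead).  Against the horn `e(x) ≤ 9/(2 log(x+2))`
   (`excess_le_log`) this sandwiches the generic world: `τ e^{−(x−1)ε/τ} ≤ e(x) ≤ 9/(2 log(x+2))`.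

NO definitions (gate rule D-0009).  Nothing here proves `ω = 2`. -/

set_option linter.dupNamespace false

noncomputable section

open scoped BigOperators

namespace Summit.MatrixMultiplication.MatrixMultiplication.Theorems.FarEdgeDescentFieldNode

open Literature.Computability.AlgebraicComplexity
open Summit.MatrixMultiplication.MatrixMultiplication.Theorems.FarEdgeDescentSpectralShadow
open Summit.MatrixMultiplication.MatrixMultiplication.Theorems.FarEdgeDescentSpectralHorn

variable {K : Type} [Field K]

/-! ## §A The node over every field -/

/-- **The chord bound, every field**: `e(m) ≤ (e(1) + e(2m−1))/2` for real `m ≥ 1` (convexity of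
`x ↦ ω_K(1,x,1)` on `[0,∞)`; `m` is the midpoint of `1` and `2m−1`). [cite: LottiRomani1983, §2 (p. 174)] -/
theorem excess_chord {m : ℝ} (hm : 1 ≤ m) :
    omegaRect K 1 m 1 - (m + 1) ≤
      ((omegaRect K 1 1 1 - 2) + (omegaRect K 1 (2 * m - 1) 1 - 2 * m)) / 2 := by
  have h := (omegaRect_convexOn_one_mid_one K).2 (Set.mem_Ici.2 (zero_le_one : (0 : ℝ) ≤ 1))
    (Set.mem_Ici.2 (by linarith : (0 : ℝ) ≤ 2 * m - 1))
    (by norm_num : (0 : ℝ) ≤ 1 / 2) (by norm_num : (0 : ℝ) ≤ 1 / 2) (by norm_num : (1 : ℝ) / 2 + 1 / 2 = 1)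
  simp only [smul_eq_mul] at h
  have e : (1 : ℝ) / 2 * 1 + 1 / 2 * (2 * m - 1) = m := by ring
  rw [e] at h
  linarith

/-- **The halving step, every field**: under `ALC_K`, `ω_K(1,2k−1,1) = 2k ⟹ ω_K(1,k,1) = k+1` for real
`k > 1` (`e(k)² ≤ e(1)·e(2k−1) = 0`). [cite: LottiRomani1983, Prop. 4.1] -/
theorem halving
    (hA : ∀ m : ℝ, 1 < m →
      (omegaRect K 1 m 1 - (m + 1)) ^ 2 ≤ (omegaRect K 1 1 1 - 2) * (omegaRect K 1 (2 * m - 1) 1 - 2 * m))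
    {k : ℝ} (hk : 1 < k) (hs : omegaRect K 1 (2 * k - 1) 1 = 2 * k) : omegaRect K 1 k 1 = k + 1 := by
  have h := hA k hk
  rw [hs, sub_self, mul_zero] at h
  have h0 : (omegaRect K 1 k 1 - (k + 1)) ^ 2 = 0 := le_antisymm h (sq_nonneg _)
  have := pow_eq_zero_iff two_ne_zero |>.1 h0
  linarith

/-- `ω_K = 2` forces `e_K ≡ 0` on `[1, ∞)` (`x ↦ ω(1,x,1) − x` is non-increasing, Lotti–Romani §2).
[cite: LottiRomani1983, §2 (p. 174)] -/
theorem excess_eq_zero_of_omega_eq_two (h2 : omega K = 2) {x : ℝ} (hx : 1 ≤ x) :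
    omegaRect K 1 x 1 = x + 1 := by
  refine le_antisymm ?_ (add_one_le_omegaRect_one_mid_one K x)
  have hmono := omegaRect_one_mid_one_sub_antitone K hx
  simp only at hmono
  rw [omegaRect_one_one_one, h2] at hmono
  linarith

/-- **THE NODE OVER EVERY FIELD: `ω_K = 2 ⟺ FS_K ∧ ALC_K`** — the cut of record
`S ⟸ FiniteSaturation ∧ AnchoredLogConvexity` with both item texts read over an arbitrary field.
(`⟹`: `e_K ≡ 0`.  `⟸`: from a saturated natural `k ≥ 2`, real halving along `k_j = 1 + (k−1)/2^j` gives
`e(k_j) = 0` for all `j`, and `ω_K = ω_K(1,1,1) ≤ ω_K(1,k_j,1) = k_j + 1 → 2` by monotonicity.)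
[cite: LottiRomani1983, Prop. 4.1; §2 (p. 174)] -/
theorem omega_eq_two_iff_node :
    omega K = 2 ↔
      (∃ k : ℕ, 2 ≤ k ∧ omegaRect K 1 k 1 = k + 1) ∧
        ∀ m : ℝ, 1 < m →
          (omegaRect K 1 m 1 - (m + 1)) ^ 2 ≤ (omegaRect K 1 1 1 - 2) * (omegaRect K 1 (2 * m - 1) 1 - 2 * m) := by
  constructor
  · intro h2
    refine ⟨⟨2, le_rfl, ?_⟩, fun m hm => ?_⟩
    · exact_mod_cast excess_eq_zero_of_omega_eq_two h2 (by norm_num : (1 : ℝ) ≤ 2)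
    · rw [excess_eq_zero_of_omega_eq_two h2 hm.le, omegaRect_one_one_one, h2]
      norm_num
  · rintro ⟨⟨k, hk2, hsat⟩, hA⟩
    have hk1 : (0 : ℝ) < (k : ℝ) - 1 := by
      have : (2 : ℝ) ≤ k := by exact_mod_cast hk2
      linarith
    -- real halving along `k_j = 1 + (k−1)/2^j`
    have hsat' : ∀ j : ℕ, omegaRect K 1 (1 + ((k : ℝ) - 1) / 2 ^ j) 1 = (1 + ((k : ℝ) - 1) / 2 ^ j) + 1 := by
      intro j
      induction j with
      | zero =>
        have e : (1 : ℝ) + ((k : ℝ) - 1) / 2 ^ 0 = k := by norm_num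
        rw [e]
        exact hsat
      | succ j ih =>
        have hpos : (0 : ℝ) < ((k : ℝ) - 1) / 2 ^ (j + 1) := by positivity
        refine halving hA (by linarith) ?_
        have e1 : 2 * (1 + ((k : ℝ) - 1) / 2 ^ (j + 1)) - 1 = 1 + ((k : ℝ) - 1) / 2 ^ j := by
          rw [pow_succ]
          field_simp
          ring
        have e2 : 2 * (1 + ((k : ℝ) - 1) / 2 ^ (j + 1)) = (1 + ((k : ℝ) - 1) / 2 ^ j) + 1 := by
          linarith [e1]
        rw [e1, e2]
        exact ih
    -- `ω_K ≤ k_j + 1` for all `j`, hence `ω_K ≤ 2`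
    have hle : ∀ j : ℕ, omega K ≤ 2 + ((k : ℝ) - 1) / 2 ^ j := by
      intro j
      have hmono := omegaRect_one_mid_one_mono K
        (show (1 : ℝ) ≤ 1 + ((k : ℝ) - 1) / 2 ^ j by
          have : (0 : ℝ) ≤ ((k : ℝ) - 1) / 2 ^ j := by positivity
          linarith)
      rw [omegaRect_one_one_one, hsat' j] at hmono
      linarith
    refine le_antisymm ?_ ?_
    · refine le_of_forall_pos_lt_add fun δ hδ => ?_
      obtain ⟨j, hj⟩ := pow_unbounded_of_one_lt (((k : ℝ) - 1) / δ) (one_lt_two : (1 : ℝ) < 2)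
      have h2j : (0 : ℝ) < 2 ^ j := by positivity
      have hsmall : ((k : ℝ) - 1) / 2 ^ j < δ := by
        rw [div_lt_iff₀ h2j]
        have := (div_lt_iff₀ hδ).1 hj
        linarith
      linarith [hle j]
    · have := two_le_omegaRect_one_mid_one K (1 : ℝ)
      rwa [omegaRect_one_one_one] at this

/-- **The cut of record, Theses-free** (over `ℂ`): `MatrixMultiplication ⟺ FS_ℂ ∧ ALC_ℂ` with both item texts
inline — the deciding equivalence behind `FarEdgeDescent.closes`, importable without the Theses cone.
[cite: LottiRomani1983, Prop. 4.1] -/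
theorem matrixMultiplication_iff_node :
    _root_.MatrixMultiplication ↔
      (∃ k : ℕ, 2 ≤ k ∧ omegaRect ℂ 1 k 1 = k + 1) ∧
        ∀ m : ℝ, 1 < m →
          (omegaRect ℂ 1 m 1 - (m + 1)) ^ 2 ≤ (omegaRect ℂ 1 1 1 - 2) * (omegaRect ℂ 1 (2 * m - 1) 1 - 2 * m) :=
  _root_.MatrixMultiplication_iff.trans omega_eq_two_iff_node

/-- **The all-fields summit through the same cut**: `(∀ K, ω_K = 2) ⟺ ∀ K, FS_K ∧ ALC_K`.
[cite: LottiRomani1983, Prop. 4.1] -/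
theorem matrixMultiplicationAllFields_iff_node :
    MatrixMultiplicationAllFields ↔
      ∀ (L : Type) [Field L],
        (∃ k : ℕ, 2 ≤ k ∧ omegaRect L 1 k 1 = k + 1) ∧
          ∀ m : ℝ, 1 < m →
            (omegaRect L 1 m 1 - (m + 1)) ^ 2 ≤
              (omegaRect L 1 1 1 - 2) * (omegaRect L 1 (2 * m - 1) 1 - 2 * m) :=
  ⟨fun h L _ => omega_eq_two_iff_node.1 (h L), fun h L _ => omega_eq_two_iff_node.2 (h L)⟩

/-- **The special leaf = bounded cone slope** (every field): `FS_K ⟺ ∃ M : ℝ, ∀φ, d_φ ≤ M·(1−θ₂)` — the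
shadow `{(1−θ₂, θ₁+θ₂+θ₃−2)}` lies under SOME line through the origin (real slope) iff under a cone of
natural slope `k−1`, `k ≥ 2` (`finiteSaturationShape_iff_cone` + Archimedes).  So the special crux
concerns only the SHALLOW dark points (`1−θ₂ → 0`). [cite: Strassen1988, Thm. 3.8]
[cite: AlmanLi2026, Proposition 4.2] -/
theorem finiteSaturationShape_iff_slopeBounded :
    (∃ k : ℕ, 2 ≤ k ∧ omegaRect K 1 k 1 = k + 1) ↔
      ∃ M : ℝ, ∀ F : SpectralMap K, IsUniversalSpectralPoint K F →
        (∑ i, specMMPoint K F i) - 2 ≤ M * (1 - specMMPoint K F 1) := by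
  rw [finiteSaturationShape_iff_cone]
  constructor
  · rintro ⟨k, -, hk⟩
    exact ⟨(k : ℝ) - 1, hk⟩
  · rintro ⟨M, hM⟩
    refine ⟨⌈M⌉₊ + 2, by omega, fun F hF => (hM F hF).trans ?_⟩
    have hε : 0 ≤ 1 - specMMPoint K F 1 := by linarith [(AlmanLi2026.prop42_mem_Icc hF 1).2]
    refine mul_le_mul_of_nonneg_right ?_ hε
    have := Nat.le_ceil M
    push_cast
    linarith

/-! ## §B The top-depth floor -/

/-- **Every top point bounds the excess from below, linearly** (unconditional, every field): if
`θ₁+θ₂+θ₃ = ω_K` then `e(x) ≥ (ω_K − 2) − (x−1)·(1−θ₂)` for every real `x ≥ 0` (the top point's own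
spectral line). [cite: Strassen1988, Thm. 3.8] [cite: AlmanLi2026, Proposition 4.2] -/
theorem excess_ge_top_line {F : SpectralMap K} (hF : IsUniversalSpectralPoint K F)
    (htop : ∑ i, specMMPoint K F i = omega K) {x : ℝ} (hx : 0 ≤ x) :
    (omega K - 2) - (x - 1) * (1 - specMMPoint K F 1) ≤ omegaRect K 1 x 1 - (x + 1) := by
  have h := line_le_omegaRect hF hx
  rw [← htop, sum_three]
  have e : (x - 1) * (1 - specMMPoint K F 1) = x - 1 - x * specMMPoint K F 1 + specMMPoint K F 1 := by
    ring
  rw [e]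
  linarith

/-- **One doubling (quantitative top isolation)**: under `ALC_K` and `ω_K > 2`, for a top point of depth
`ε = 1−θ₂` and every real `m > 1` with `(m−1)ε ≤ τ = ω_K − 2`,
`e(2m−1) ≥ (τ − (m−1)ε)²/τ` — strictly above the top line's value `τ − 2(m−1)ε` by `(m−1)²ε²/τ`.
[cite: Strassen1988, Thm. 3.8] -/
theorem excess_double_ge_sq
    (hA : ∀ m : ℝ, 1 < m →
      (omegaRect K 1 m 1 - (m + 1)) ^ 2 ≤ (omegaRect K 1 1 1 - 2) * (omegaRect K 1 (2 * m - 1) 1 - 2 * m))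
    (hω : 2 < omega K) {F : SpectralMap K} (hF : IsUniversalSpectralPoint K F)
    (htop : ∑ i, specMMPoint K F i = omega K) {m : ℝ} (hm : 1 < m)
    (hle : (m - 1) * (1 - specMMPoint K F 1) ≤ omega K - 2) :
    ((omega K - 2) - (m - 1) * (1 - specMMPoint K F 1)) ^ 2 / (omega K - 2) ≤
      omegaRect K 1 (2 * m - 1) 1 - 2 * m := by
  have hτ : 0 < omega K - 2 := by linarith
  have h1 := excess_ge_top_line hF htop (by linarith : (0 : ℝ) ≤ m)
  have h0 : 0 ≤ (omega K - 2) - (m - 1) * (1 - specMMPoint K F 1) := by linarith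
  have h2 : ((omega K - 2) - (m - 1) * (1 - specMMPoint K F 1)) ^ 2 ≤ (omegaRect K 1 m 1 - (m + 1)) ^ 2 :=
    pow_le_pow_left₀ h0 h1 2
  have h3 := hA m hm
  rw [omegaRect_one_one_one] at h3
  rw [div_le_iff₀ hτ]
  linarith

/-- **THE TOP-DEPTH FLOOR**: under `ALC_K` and `ω_K > 2`, for a top point of depth `ε = 1−θ₂`,
`τ = ω_K − 2`, every `j` and every real `x ≥ 1` with `(x−1)ε ≤ 2^j τ`:
`e(x) ≥ τ · (1 − (x−1)ε/(2^j τ))^{2^j}` (`j` halvings of `[1,x]` and `j` applications of the crux).  As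
`j → ∞` the right side increases to `τ·exp(−(x−1)ε/τ)`: the excess decays no faster than exponentially,
at a rate set by the depth of any optimal spectral certificate of `⟨n,n,n⟩`. [cite: Strassen1988, Thm. 3.8]
[cite: LottiRomani1983, Prop. 4.1] -/
theorem excess_ge_floor
    (hA : ∀ m : ℝ, 1 < m →
      (omegaRect K 1 m 1 - (m + 1)) ^ 2 ≤ (omegaRect K 1 1 1 - 2) * (omegaRect K 1 (2 * m - 1) 1 - 2 * m))
    (hω : 2 < omega K) {F : SpectralMap K} (hF : IsUniversalSpectralPoint K F)
    (htop : ∑ i, specMMPoint K F i = omega K) (j : ℕ) :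
    ∀ {x : ℝ}, 1 ≤ x → (x - 1) * (1 - specMMPoint K F 1) ≤ 2 ^ j * (omega K - 2) →
      (omega K - 2) * (1 - (x - 1) * (1 - specMMPoint K F 1) / (2 ^ j * (omega K - 2))) ^ (2 ^ j) ≤
        omegaRect K 1 x 1 - (x + 1) := by
  have hτ : 0 < omega K - 2 := by linarith
  induction j with
  | zero =>
    intro x hx _
    have h := excess_ge_top_line hF htop (by linarith : (0 : ℝ) ≤ x)
    have e : (omega K - 2) * (1 - (x - 1) * (1 - specMMPoint K F 1) / (2 ^ 0 * (omega K - 2))) ^ (2 ^ 0) =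
        (omega K - 2) - (x - 1) * (1 - specMMPoint K F 1) := by
      rw [pow_zero, pow_zero, pow_one, one_mul]
      field_simp
    rw [e]
    exact h
  | succ j ih =>
    intro x hx hle
    set ε : ℝ := 1 - specMMPoint K F 1 with hε
    have hε0 : 0 ≤ ε := by
      have := (AlmanLi2026.prop42_mem_Icc hF 1).2
      rw [hε]
      linarith
    -- the base `B = 1 − (x−1)ε/(2^{j+1} τ) ∈ [0, 1]`
    set B : ℝ := 1 - (x - 1) * ε / (2 ^ (j + 1) * (omega K - 2)) with hB
    have h2j : (0 : ℝ) < 2 ^ (j + 1) * (omega K - 2) := by positivity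
    have hB0 : 0 ≤ B := by
      rw [hB, sub_nonneg, div_le_one h2j]
      exact hle
    rcases hx.lt_or_eq with hx1 | hx1
    · -- `x > 1`: halve at `m = (x+1)/2`
      have hm : 1 < (x + 1) / 2 := by linarith
      have hmx : ((x + 1) / 2 - 1) * ε ≤ 2 ^ j * (omega K - 2) := by
        rw [pow_succ] at hle
        nlinarith [hle]
      have ihm := ih hm.le hmx
      -- the inductive base at `m` is the same number `B`
      have eB : 1 - ((x + 1) / 2 - 1) * ε / (2 ^ j * (omega K - 2)) = B := by
        rw [hB, pow_succ]
        field_simp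
        ring
      rw [eB] at ihm
      -- `ihm : τ B^{2^j} ≤ e(m)`; the crux at `m`: `e(m)² ≤ τ e(x)`
      have hAm := hA ((x + 1) / 2) hm
      have e2m : 2 * ((x + 1) / 2) - 1 = x := by ring
      have e2m' : 2 * ((x + 1) / 2) = x + 1 := by ring
      rw [e2m, e2m', omegaRect_one_one_one] at hAm
      have hpos : 0 ≤ (omega K - 2) * B ^ (2 ^ j) := mul_nonneg hτ.le (pow_nonneg hB0 _)
      have hsq : ((omega K - 2) * B ^ (2 ^ j)) ^ 2 ≤ (omegaRect K 1 ((x + 1) / 2) 1 - ((x + 1) / 2 + 1)) ^ 2 :=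
        pow_le_pow_left₀ hpos ihm 2
      have epow : ((omega K - 2) * B ^ (2 ^ j)) ^ 2 = (omega K - 2) * ((omega K - 2) * B ^ (2 ^ (j + 1))) := by
        rw [show (2 : ℕ) ^ (j + 1) = 2 ^ j * 2 from pow_succ 2 j, pow_mul]
        ring
      rw [epow] at hsq
      -- divide `τ · (τ B^{2^{j+1}}) ≤ e(m)² ≤ τ e(x)` by `τ > 0`
      have h4 : (omega K - 2) * ((omega K - 2) * B ^ (2 ^ (j + 1))) ≤
          (omega K - 2) * (omegaRect K 1 x 1 - (x + 1)) := hsq.trans hAm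
      exact le_of_mul_le_mul_left h4 hτ
    · -- `x = 1`: `B = 1` and `e(1) = τ`
      have hB1 : B = 1 := by
        rw [hB, ← hx1]
        ring
      rw [hB1, one_pow, mul_one, ← hx1, omegaRect_one_one_one]
      linarith

/-- **THE TOP-DEPTH FLOOR, limit form**: under `ALC_K` and `ω_K > 2`, for a top point of depth `ε = 1−θ₂` and
every real `x ≥ 1`, **`e(x) ≥ τ · exp(−(x−1)ε/τ)`**, `τ = ω_K − 2` (let `j → ∞` in `excess_ge_floor`:
`(1 − c/2^j)^{2^j} → e^{−c}`). [cite: Strassen1988, Thm. 3.8] [cite: LottiRomani1983, Prop. 4.1] -/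
theorem excess_ge_exp_floor
    (hA : ∀ m : ℝ, 1 < m →
      (omegaRect K 1 m 1 - (m + 1)) ^ 2 ≤ (omegaRect K 1 1 1 - 2) * (omegaRect K 1 (2 * m - 1) 1 - 2 * m))
    (hω : 2 < omega K) {F : SpectralMap K} (hF : IsUniversalSpectralPoint K F)
    (htop : ∑ i, specMMPoint K F i = omega K) {x : ℝ} (hx : 1 ≤ x) :
    (omega K - 2) * Real.exp (-((x - 1) * (1 - specMMPoint K F 1) / (omega K - 2))) ≤
      omegaRect K 1 x 1 - (x + 1) := by
  have hτ : 0 < omega K - 2 := by linarith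
  set c : ℝ := (x - 1) * (1 - specMMPoint K F 1) / (omega K - 2) with hc
  -- `τ (1 + (−c)/2^j)^{2^j} → τ e^{−c}` along `j → ∞`
  have hlim : Filter.Tendsto (fun j : ℕ => (omega K - 2) * (1 + -c / ((2 ^ j : ℕ) : ℝ)) ^ (2 ^ j))
      Filter.atTop (nhds ((omega K - 2) * Real.exp (-c))) :=
    ((Real.tendsto_one_add_div_pow_exp (-c)).comp
      (tendsto_pow_atTop_atTop_of_one_lt (by norm_num : (1 : ℕ) < 2))).const_mul _
  refine le_of_tendsto hlim ?_
  -- eventually (once `c ≤ 2^j`) each term is below `e(x)` by `excess_ge_floor`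
  obtain ⟨J, hJ⟩ := pow_unbounded_of_one_lt c (one_lt_two : (1 : ℝ) < 2)
  refine Filter.eventually_atTop.2 ⟨J, fun j hj => ?_⟩
  have h2j : (2 : ℝ) ^ J ≤ 2 ^ j := pow_le_pow_right₀ one_le_two hj
  have hle : (x - 1) * (1 - specMMPoint K F 1) ≤ 2 ^ j * (omega K - 2) := by
    have hcj : c ≤ 2 ^ j := by linarith
    rw [hc, div_le_iff₀ hτ] at hcj
    exact hcj
  have h := excess_ge_floor hA hω hF htop j hx hle
  have e : (1 : ℝ) + -c / ((2 ^ j : ℕ) : ℝ) = 1 - (x - 1) * (1 - specMMPoint K F 1) / (2 ^ j * (omega K - 2)) := by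
    rw [hc]
    push_cast
    rw [neg_div, div_div, mul_comm (omega K - 2), ← sub_eq_add_neg]
  show (omega K - 2) * (1 + -c / ((2 ^ j : ℕ) : ℝ)) ^ (2 ^ j) ≤ omegaRect K 1 x 1 - (x + 1)
  rw [e]
  exact h

/-- **The sandwich of the generic world** (every field): under `ALC_K` and `ω_K > 2`, for a top point of
depth `ε`, every natural `k ≥ 1` and every `j` with `(k−1)ε ≤ 2^j τ`,
`τ·(1 − (k−1)ε/(2^j τ))^{2^j} ≤ e(k) ≤ 9/(2·log(k+2))` — exponential floor against logarithmic horn.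
[cite: LottiRomani1983, Prop. 4.1] [cite: Strassen1988, Thm. 3.8] -/
theorem floor_le_log
    (hA : ∀ m : ℝ, 1 < m →
      (omegaRect K 1 m 1 - (m + 1)) ^ 2 ≤ (omegaRect K 1 1 1 - 2) * (omegaRect K 1 (2 * m - 1) 1 - 2 * m))
    (hω : 2 < omega K) {F : SpectralMap K} (hF : IsUniversalSpectralPoint K F)
    (htop : ∑ i, specMMPoint K F i = omega K) (j : ℕ) {k : ℕ} (hk : 1 ≤ k)
    (hle : ((k : ℝ) - 1) * (1 - specMMPoint K F 1) ≤ 2 ^ j * (omega K - 2)) :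
    (omega K - 2) * (1 - ((k : ℝ) - 1) * (1 - specMMPoint K F 1) / (2 ^ j * (omega K - 2))) ^ (2 ^ j) ≤
      9 / (2 * Real.log ((k : ℝ) + 2)) :=
  (excess_ge_floor hA hω hF htop j (by exact_mod_cast hk) hle).trans (excess_le_log (K := K) k)

end Summit.MatrixMultiplication.MatrixMultiplication.Theorems.FarEdgeDescentFieldNode

end
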